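import Summits.CriticalPhenomena.PercolationContinuityZ3.Theorems.PercAnnulusCrossingIICResistanceUpper
import Summits.CriticalPhenomena.PercolationContinuityZ3.Theorems.PercAnnulusCrossingIICChemicalDistanceDeterministic
import HarnessLib

/-!
# Bottlenecks of the arm, IX: under the IIC the resistance to `Λ(n)ᶜ` is at most twice the chemical exit distance, hence at most twice the volume (lane RSW3, p1 gen 27)

builds on p205010 (kernel theorem, internal audit signed; external expert review pending) — NOT used in this file (every `d ≥ 1`, `p > 0`, every
IIC probability measure; no (A2)).

RSW3 lane (LANE 3 `prim-rsw3`), seat `prim-rsw3-p1` (gen 27).  Helper file (`--supports stmt-CriticalPhenomena-4575`); no definitions,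
no sorries.  Memo `run/shared/lean/prim/rsw3/P1-QM.md` §40.5.

`…IICResistanceUpper` built the unit flow along an open path (`R_eff(0 ↔ Λ(n)ᶜ) ≤ 2·length`).  Under Kesten's IIC the root's cluster leaves
every box, the chemical exit distance `D_n = ⨅_{v ∉ Λ(n)} dist_ω(0,v)` is finite and attained (gen 14/15 `…IICChemicalDistance*`), and
`D_n ≤ #{z ∈ Λ(n) : 0 ↔ z}` (`iicMeasure_ae_chemical_le_volume`).  Hence:

* **`iicMeasure_ae_exists_unitFlow_energy_le_chemical`** — `ν`-a.s., for EVERY `n`, there is a unit flow from the root on the open edges,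
  divergence-free on `Λ(n) ∖ {0}`, with energy `≤ 2·D_n`;
* **`iicMeasure_ae_exists_unitFlow_energy_le_volume`** — … with energy `≤ 2·#{z ∈ Λ(n) : 0 ↔ z}` (`R_eff(0 ↔ Λ(n)ᶜ) ≤ 2·|C(0) ∩ Λ(n)|`);
* with `…IICResistanceGrowth` (under UAD, `> (log_L n)/2` from below) this is the two-sided a.s. frame
  `c·log n ≤ R_eff(0 ↔ Λ(n)ᶜ) ≤ 2·D_n ≤ 2·V_n` for the resistance of the incipient infinite cluster.
References: R. Lyons, Y. Peres, *Probability on Trees and Networks* (2016) §2.4; M. Heydenreich, R. van der Hofstad (2017) §14.3;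
H. Kesten, AIHP 22 (1986).
-/

noncomputable section

namespace Summit.CriticalPhenomena.PercolationContinuityZ3.Theorems.Crossing

open MeasureTheory Filter Topology Literature.Probability.Percolation Literature.Probability.LatticeModels
open Literature.Probability.Percolation.DCT16
open scoped Literature.Probability.Percolation ENNReal

variable {d : ℕ}

/-- **`R_eff(0 ↔ Λ(n)ᶜ) ≤ 2·(CHEMICAL EXIT DISTANCE)` UNDER THE IIC** (`d ≥ 1`, `0 < p`; every IIC probability measure): `ν`-a.s., for every
`n`, there is an antisymmetric `f` on the open edges with unit out-flow at the root, divergence-free on `Λ(n) ∖ {0}`, `Σ f² < ∞` and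
`Σ f² ≤ 2·⨅_{v ∉ Λ(n)} dist_ω(0, v)` (the flow along a chemical geodesic to the nearest site outside `Λ(n)`). [cite: LyonsPeres2016, §2.4] -/
theorem iicMeasure_ae_exists_unitFlow_energy_le_chemical (hd : 1 ≤ d) (p : unitInterval) (hp : 0 < (p : ℝ))
    {ν : Measure (BondConfig (Site d))} [IsProbabilityMeasure ν]
    (hν : ∀ (F : Finset (Sym2 (Site d))) (E : Set (BondConfig (Site d))), MeasurableSet E → DeterminedBy E ↑F →
      Tendsto (fun n : ℕ => (bondPercolation (zdGraph d) p).real (E ∩ siteToBoundary d n) / oneArmProb d p n)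
        atTop (𝓝 (ν.real E))) :
    ∀ᵐ ω ∂ν, ∀ n : ℕ, ∃ f : Site d → Site d → ℝ, (∀ x y, f x y = -f y x) ∧ (∀ x y, f x y ≠ 0 → (zdGraph d).Adj x y ∧ s(x, y) ∈ ω) ∧
      (∀ x ∈ box d n, x ≠ 0 → ∑ y ∈ (zdGraph d).neighborFinset x, f x y = 0) ∧ ∑ y ∈ (zdGraph d).neighborFinset 0, f 0 y = 1 ∧
      Summable (fun q : Site d × Site d => f q.1 q.2 ^ 2) ∧
      ∑' q : Site d × Site d, f q.1 q.2 ^ 2 ≤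
        2 * (((⨅ v : {v : Site d // v ∉ box d n}, (openGraph ω).edist (0 : Site d) v.1).toNat : ℕ) : ℝ) := by
  filter_upwards [iicMeasure_ae_subset_edgeSet p hν, iicMeasure_ae_succ_le_chemical_ne_top hd p hp hν] with ω hlat hchem
  intro n
  obtain ⟨-, hDfin⟩ := hchem n
  -- the infimum is over a nonempty type and attained
  haveI : Nonempty {v : Site d // v ∉ box d n} := by
    by_contra hemp
    rw [not_nonempty_iff] at hemp
    exact hDfin (iInf_of_empty _)
  obtain ⟨⟨v, hv⟩, hvD⟩ := exists_eq_iInf_enat (fun v : {v : Site d // v ∉ box d n} => (openGraph ω).edist (0 : Site d) v.1)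
  have hvD' : (openGraph ω).edist 0 v = ⨅ v : {v : Site d // v ∉ box d n}, (openGraph ω).edist (0 : Site d) v.1 := hvD
  have hvfin : (openGraph ω).edist 0 v ≠ ⊤ := by rw [hvD']; exact hDfin
  obtain ⟨pth, hpth⟩ := SimpleGraph.exists_walk_of_edist_ne_top hvfin
  -- the flow along the (bypassed) geodesic
  obtain ⟨f, h1, h2, h3, h4, h5, h6⟩ := exists_unitFlow_energy_le_two_mul_length hlat hv pth.bypass (SimpleGraph.Walk.bypass_isPath _)
  refine ⟨f, h1, h2, h3, h4, h5, h6.trans ?_⟩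
  have hlen : (pth.bypass.length : ℝ) ≤ (((⨅ v : {v : Site d // v ∉ box d n}, (openGraph ω).edist (0 : Site d) v.1).toNat : ℕ) : ℝ) := by
    have h1 : pth.bypass.length ≤ pth.length := SimpleGraph.Walk.length_bypass_le_length _
    have h2 : ((pth.length : ℕ∞)).toNat = pth.length := rfl
    rw [← hvD', ← hpth, h2]
    exact_mod_cast h1
  linarith

open scoped Classical in
/-- **`R_eff(0 ↔ Λ(n)ᶜ) ≤ 2·|C(0) ∩ Λ(n)|` UNDER THE IIC** (`d ≥ 1`, `0 < p`): `ν`-a.s., for every `n`, a unit flow from the root divergence-free on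
`Λ(n) ∖ {0}` with energy `≤ 2·#{z ∈ Λ(n) : 0 ↔ z}` (chemical exit distance `≤` volume, `…IICChemicalDistanceDeterministic`).  With
`…IICResistanceGrowth`: `c·log n ≤ R_eff ≤ 2 V_n` along Kesten's IIC. [cite: LyonsPeres2016, §2.4] [cite: Kesten1986, §3] -/
theorem iicMeasure_ae_exists_unitFlow_energy_le_volume (hd : 1 ≤ d) (p : unitInterval) (hp : 0 < (p : ℝ))
    {ν : Measure (BondConfig (Site d))} [IsProbabilityMeasure ν]
    (hν : ∀ (F : Finset (Sym2 (Site d))) (E : Set (BondConfig (Site d))), MeasurableSet E → DeterminedBy E ↑F →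
      Tendsto (fun n : ℕ => (bondPercolation (zdGraph d) p).real (E ∩ siteToBoundary d n) / oneArmProb d p n)
        atTop (𝓝 (ν.real E))) :
    ∀ᵐ ω ∂ν, ∀ n : ℕ, ∃ f : Site d → Site d → ℝ, (∀ x y, f x y = -f y x) ∧ (∀ x y, f x y ≠ 0 → (zdGraph d).Adj x y ∧ s(x, y) ∈ ω) ∧
      (∀ x ∈ box d n, x ≠ 0 → ∑ y ∈ (zdGraph d).neighborFinset x, f x y = 0) ∧ ∑ y ∈ (zdGraph d).neighborFinset 0, f 0 y = 1 ∧
      Summable (fun q : Site d × Site d => f q.1 q.2 ^ 2) ∧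
      ∑' q : Site d × Site d, f q.1 q.2 ^ 2 ≤
        2 * ((((box d n).filter fun z => ω ∈ (openConn (0 : Site d) z : Set (BondConfig (Site d)))).card : ℕ) : ℝ) := by
  filter_upwards [iicMeasure_ae_exists_unitFlow_energy_le_chemical hd p hp hν, iicMeasure_ae_chemical_le_volume hd p hp hν] with ω hω hvol
  intro n
  obtain ⟨f, h1, h2, h3, h4, h5, h6⟩ := hω n
  refine ⟨f, h1, h2, h3, h4, h5, h6.trans ?_⟩
  have h := (hvol n).2
  have h' : ((((⨅ v : {v : Site d // v ∉ box d n}, (openGraph ω).edist (0 : Site d) v.1).toNat : ℕ) : ℝ)) ≤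
      ((((box d n).filter fun z => ω ∈ (openConn (0 : Site d) z : Set (BondConfig (Site d)))).card : ℕ) : ℝ) := by
    exact_mod_cast h
  linarith

end Summit.CriticalPhenomena.PercolationContinuityZ3.Theorems.Crossing

end
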